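import Literature.NumberTheory.IwasawaTheory.Greenberg2006.CohomologyCofiniteGenerationHolds
import Literature.NumberTheory.GaloisCohomology.RestrictedRamificationFiniteCoefficientsLeTwoOfTate
import HarnessLib

/-!
# Greenberg 2006, Prop. 3.2 IN DEGREES `≤ 2` — the degrees its consumers read — for every number
# field, from Tate's global Euler–Poincaré characteristic (Milne I Thm. 5.1) ALONE

Topic `NumberTheory/IwasawaTheory/Greenberg2006`; namespace
`Literature.NumberTheory.IwasawaTheory.Greenberg2006`; THEOREMS ONLY (no definition, no named fact,
no `sorry`, no instance).

The named fact `prop32_cohomology_isCofinitelyGenerated` (Greenberg 2006 Prop. 3.2: `Hⁱ(K_Σ/K, 𝒟)`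
and `Hⁱ(K_v, 𝒟)` are cofinitely generated, EVERY `i`, every number field `K`, every prime `p`) is
derived in the tree from the two textbook facts {Milne I Thm. 5.1, Harari Thm. 17.13 (a)}
(`prop32_cohomology_isCofinitelyGenerated_of_tate_of_poitouTate_three_le`), Poitou–Tate being needed
for the finiteness of `Hⁱ(G_S, α)`, `i ≥ 3`, at number fields with real places.  Its consumers on the
Eisenstein-primes line (`AcTwistDeformationLEO` — `i = 2`, `…GreenbergFullAtSqueeze` — `i = 1`,
`WeakLeopoldtAbove` — `i = 2`; the local clause everywhere) read the global clause in degrees `i ≤ 2`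
ONLY.  This file supplies exactly that, modulo Milne I Thm. 5.1 alone:

* `isCofinitelyGenerated_H_of_finiteCoefficients_le` — Prop. 3.2 in degrees `≤ N` for ONE compact
  group under hypothesis (F) in degrees `≤ N` (the tree's degree-truncated dévissage
  `ContinuousRep.module_finite_characterModule_continuousCohomology_of_le`, in the
  `IsCofinitelyGenerated` idiom of the named fact; twin of `isCofinitelyGenerated_H_of_finiteCoefficients`);
* `isCofinitelyGenerated_H_le_two_of_tate` — for `Γ = G_{K,S}`: `Hⁱ(K_Σ/K, 𝒟)` is cofinitely
  generated for `i ≤ 2`, granted `tateGlobalEulerPoincareCharacteristic K` (hypothesis (F) (ii) in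
  degrees `≤ 2` is `hypothesisF_le_two_galoisGroupUnramifiedOutside_of_tate`);
* **`prop32_global_le_two_of_tate`** — READING LEMMA in the exact binder shape of
  `prop32_cohomology_isCofinitelyGenerated.global` with the fact replaced by
  `∀ L, tateGlobalEulerPoincareCharacteristic L` and the degree restricted to `i ≤ 2` (auto-param
  `by omega`, so a consumer's `h32.global hSf hS hΛ ρ hp hcf 2` becomes
  `prop32_global_le_two_of_tate h32 hSf hS hΛ ρ hp hcf 2`);
* **`prop32_local_of_holds`** — READING LEMMA in the binder shape of
  `prop32_cohomology_isCofinitelyGenerated.local`, UNCONDITIONAL (`prop32_local_holds`).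

PRINT (Greenberg 2006, p. 358 L37): "Proposition 3.2. For any `i ≥ 0`, `Hⁱ(G, D)` is a cofinitely
generated `R`-module."; standing hypothesis p. 358 L8–13: "the cohomology groups `Hⁱ(G, α_k)` are
finite for all `i ≥ 0` … (ii) `G = Gal(K_Σ/K)`"; the dévissage (proof p. 358 L38 – p. 359 L18) for
`Hⁿ` involves `Hⁿ` and `Hⁿ⁻¹` of subquotients only.

## References
* R. Greenberg, *On the structure of certain Galois cohomology groups*, Doc. Math. Extra Vol.
  Coates (2006) 335–391, §3 A Prop. 3.2 (p. 358) with proof (pp. 358–359). [Greenberg2006]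
* J. S. Milne, *Arithmetic Duality Theorems*, 2nd ed. (2006), I Thm. 5.1 (p. 67). [MilneADT2006]
* J. Neukirch, A. Schmidt, K. Wingberg, *Cohomology of Number Fields*, 2nd ed. (2008), (8.3.20).
  [NeukirchSchmidtWingberg2008]
-/

noncomputable section

open scoped Classical
open CategoryTheory TopRep ContinuousCohomology
open NumberField IsDedekindDomain Field IsLocalRing
open Literature.NumberTheory.GaloisRepresentations
open Literature.NumberTheory.GaloisCohomology
open Literature.NumberTheory.IwasawaTheory.Greenberg2016
open Literature.Algebra.Module

namespace Literature.NumberTheory.IwasawaTheory.Greenberg2006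

/-! ### §1. Prop. 3.2 in degrees `≤ N` for ONE compact group under (F) in degrees `≤ N` -/

section OneGroup

variable {p : ℕ} [Fact p.Prime] {m : ℕ}
  {Λ : Type} [CommRing Λ] [TopologicalSpace Λ] [IsLocalRing Λ]
  {Γ : Type} [Group Γ] [TopologicalSpace Γ] [IsTopologicalGroup Γ] [CompactSpace Γ]
  {D : Type} [AddCommGroup D] [Module Λ D] [TopologicalSpace D] [DiscreteTopology D]
  [ContinuousSMul Λ D]

/-- **Greenberg 2006, Prop. 3.2 IN DEGREES `≤ N` for one compact group `Γ` under the standing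
hypothesis (F) IN DEGREES `≤ N`**, at `Λ ≅ ℤ_p⟦T₁,…,T_m⟧` and in the idiom of the named facts: if
`Hⁿ(Γ, A)` is finite for every finite discrete `Λ[Γ]`-module `A` killed by `𝔪_Λ` (hence by `p`) and
every `n ≤ N`, then for every discrete COFINITELY GENERATED `Λ[Γ]`-module `𝒟` and every `n ≤ N`,
`Hⁿ(Γ, 𝒟) = ρ.H n` is cofinitely generated.  The tree's degree-truncated dévissage
`ContinuousRep.module_finite_characterModule_continuousCohomology_of_le` (print's proof, `I = 𝔪`,
which for `Hⁿ` only involves `Hⁿ` and `Hⁿ⁻¹` of subquotients) composed with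
`isCofinitelyGenerated_iff_module_finite_characterModule`.
[cite: Greenberg2006, Prop. 3.2 (p. 358 L37; standing hypothesis p. 358 L8–13; proof p. 358 L38 – p. 359 L18)] -/
theorem isCofinitelyGenerated_H_of_finiteCoefficients_le (e : Λ ≃+* MvPowerSeries (Fin m) ℤ_[p])
    (N : ℕ)
    (hF : ∀ (A : Type) [AddCommGroup A] [Module Λ A] [TopologicalSpace A] [DiscreteTopology A]
      [ContinuousSMul Λ A] [Finite A] (τ : ContinuousRep Γ Λ A),
      (∀ r ∈ maximalIdeal Λ, ∀ a : A, r • a = 0) → (∀ a : A, (p : ℤ) • a = 0) →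
      ∀ n ≤ N, Finite (continuousCohomology n τ.toTopRep))
    (ρ : ContinuousRep Γ Λ D) (hD : IsCofinitelyGenerated Λ D) {n : ℕ} (hn : n ≤ N) :
    IsCofinitelyGenerated Λ (ρ.H n) := by
  haveI := isNoetherianRing_of_ringEquiv_mvPowerSeries e
  haveI := isAdicComplete_maximalIdeal_of_ringEquiv_mvPowerSeries e
  haveI := finite_quotient_maximalIdeal_of_ringEquiv_mvPowerSeries e
  haveI : Module.Finite Λ (CharacterModule D) :=
    isCofinitelyGenerated_iff_module_finite_characterModule.mp hD
  have key := ContinuousRep.module_finite_characterModule_continuousCohomology_of_le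
    (maximalIdeal Λ) N
    (fun A _ _ _ _ _ _ τ hkill k hk => hF A τ hkill
      (zsmul_eq_zero_of_forall_maximalIdeal_smul_eq_zero e hkill) k hk) ρ hn
  exact isCofinitelyGenerated_iff_module_finite_characterModule.mpr key

end OneGroup

/-! ### §2. `Γ = G_{K,S}`: degrees `≤ 2` from Tate's formula alone -/

/-- **`Hⁱ(K_Σ/K, 𝒟)` is cofinitely generated for `i ≤ 2`, GRANTED Tate's global Euler–Poincaré
characteristic for `K` (Milne I Thm. 5.1) and nothing else** — every number field `K`, every prime
`p`: for `Λ ≅ ℤ_p⟦T₁,…,T_m⟧`, `S ∋ (v ∣ p)` finite and a discrete cofinitely generated `𝒟` with a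
continuous `Λ`-linear `G_{K,S}`-action.  Hypothesis (F) (ii) in degrees `≤ 2` is
`hypothesisF_le_two_galoisGroupUnramifiedOutside_of_tate` (`H⁰` invariants, `H¹` Hermite, `H²` Tate).
[cite: Greenberg2006, Prop. 3.2 (p. 358 L37) with §3 A p. 358 L8–13 (ii)]
[cite: MilneADT2006, Ch. I §5, Thm. 5.1 (p. 67)] -/
theorem isCofinitelyGenerated_H_le_two_of_tate {K : Type} [Field K] [NumberField K]
    (hT : tateGlobalEulerPoincareCharacteristic K) {p : ℕ} [Fact p.Prime]
    (S : Set (HeightOneSpectrum (𝓞 K))) (hS : S.Finite)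
    (hSp : ∀ v : HeightOneSpectrum (𝓞 K), ((p : ℕ) : 𝓞 K) ∈ v.asIdeal → v ∈ S)
    {Λ : Type} [CommRing Λ] [TopologicalSpace Λ] [IsTopologicalRing Λ] {mΛ : ℕ}
    (e : Λ ≃+* MvPowerSeries (Fin mΛ) ℤ_[p])
    {D : Type} [AddCommGroup D] [Module Λ D] [TopologicalSpace D] [DiscreteTopology D]
    [ContinuousSMul Λ D] (ρ : ContinuousRep (GaloisGroupUnramifiedOutside K S) Λ D)
    (hD : IsCofinitelyGenerated Λ D) {i : ℕ} (hi : i ≤ 2) :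
    IsCofinitelyGenerated Λ (ρ.H i) := by
  haveI : IsLocalRing Λ := isLocalRing_of_ringEquiv_mvPowerSeries e
  refine isCofinitelyGenerated_H_of_finiteCoefficients_le e 2
    (fun A _ _ _ _ _ _ τ hkill _ n hn => ?_) ρ hD hi
  exact hypothesisF_le_two_galoisGroupUnramifiedOutside_of_tate S hT hS p hSp (maximalIdeal Λ)
    (natCast_mem_maximalIdeal_of_ringEquiv_mvPowerSeries e) A τ hkill n hn

/-! ### §3. Reading lemmas in the binder shape of the named fact's `.global` / `.local` -/

/-- **READING LEMMA — Prop. 3.2, global case (ii), IN DEGREES `i ≤ 2`, from Tate's formula by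
name**: the exact binder shape of `prop32_cohomology_isCofinitelyGenerated.global` with the named
fact `prop32_cohomology_isCofinitelyGenerated` replaced by
`∀ L, tateGlobalEulerPoincareCharacteristic L` (Milne I Thm. 5.1, every number field) and the degree
bound `i ≤ 2` as an auto-param (so `h.global hSf hS hΛ ρ hp hcf 2` ↦
`prop32_global_le_two_of_tate h hSf hS hΛ ρ hp hcf 2` at a consumer).
[cite: Greenberg2006, Prop. 3.2 (p. 358)] [cite: MilneADT2006, Ch. I §5, Thm. 5.1 (p. 67)] -/
theorem prop32_global_le_two_of_tate
    (h : ∀ (L : Type) [Field L] [NumberField L], tateGlobalEulerPoincareCharacteristic L)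
    {p : ℕ} [Fact p.Prime] {K : Type} [Field K]
    [NumberField K] {S : Set (HeightOneSpectrum (𝓞 K))} (hSf : S.Finite)
    (hS : ∀ v : HeightOneSpectrum (𝓞 K), ((p : ℕ) : 𝓞 K) ∈ v.asIdeal → v ∈ S)
    {Λ : Type} [CommRing Λ] [TopologicalSpace Λ] [IsTopologicalRing Λ] {mΛ : ℕ}
    (hΛ : Nonempty (Λ ≃+* MvPowerSeries (Fin mΛ) ℤ_[p]))
    {D : Type} [AddCommGroup D] [Module Λ D] [TopologicalSpace D] [DiscreteTopology D]
    [ContinuousSMul Λ D] (ρ : ContinuousRep (GaloisGroupUnramifiedOutside K S) Λ D)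
    (hp : ∀ d : D, ∃ n : ℕ, (p ^ n : ℤ) • d = 0) (hcf : IsCofinitelyGenerated Λ D) (i : ℕ)
    (hi : i ≤ 2 := by omega) :
    IsCofinitelyGenerated Λ (ρ.H i) := by
  have _ := hp
  obtain ⟨e⟩ := hΛ
  exact isCofinitelyGenerated_H_le_two_of_tate (h K) S hSf hS e ρ hcf hi

/-- **READING LEMMA — Prop. 3.2, local case (i), UNCONDITIONAL**: the exact binder shape of
`prop32_cohomology_isCofinitelyGenerated.local` without the named fact (`prop32_local_holds`:
`Hⁱ(K_v, 𝒟)` is cofinitely generated at every place `v`, every `i`).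
[cite: Greenberg2006, Prop. 3.2 (p. 358); §4 p. 367 L33–39] -/
theorem prop32_local_of_holds
    {p : ℕ} [Fact p.Prime] {K : Type} [Field K]
    [NumberField K] {S : Set (HeightOneSpectrum (𝓞 K))} (hSf : S.Finite)
    (hS : ∀ v : HeightOneSpectrum (𝓞 K), ((p : ℕ) : 𝓞 K) ∈ v.asIdeal → v ∈ S)
    {Λ : Type} [CommRing Λ] [TopologicalSpace Λ] [IsTopologicalRing Λ] {mΛ : ℕ}
    (hΛ : Nonempty (Λ ≃+* MvPowerSeries (Fin mΛ) ℤ_[p]))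
    {D : Type} [AddCommGroup D] [Module Λ D] [TopologicalSpace D] [DiscreteTopology D]
    [ContinuousSMul Λ D] (ρ : ContinuousRep (GaloisGroupUnramifiedOutside K S) Λ D)
    (hp : ∀ d : D, ∃ n : ℕ, (p ^ n : ℤ) • d = 0) (hcf : IsCofinitelyGenerated Λ D)
    (v : NumberField.Place K) (i : ℕ) :
    IsCofinitelyGenerated Λ ((localRep S ρ v).H i) :=
  prop32_local_holds p K S hSf hS Λ mΛ hΛ D ρ hp hcf v i

/-- **The pair a consumer of `prop32_cohomology_isCofinitelyGenerated` at given binders reads, in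
degrees `≤ 2`, from Tate's formula for `K`**: (`∀ i ≤ 2`, `Hⁱ(K_Σ/K, 𝒟)` cofinitely generated) ∧
(`∀ v i`, `Hⁱ(K_v, 𝒟)` cofinitely generated) — the per-field twin of
`prop32_of_tate_of_poitouTate_three_le_at` without Poitou–Tate.
[cite: Greenberg2006, Prop. 3.2 (p. 358)] [cite: MilneADT2006, Ch. I §5, Thm. 5.1 (p. 67)] -/
theorem prop32_le_two_of_tate_at {K : Type} [Field K] [NumberField K]
    (hT : tateGlobalEulerPoincareCharacteristic K)
    {p : ℕ} [Fact p.Prime] (S : Set (HeightOneSpectrum (𝓞 K))) (hS : S.Finite)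
    (hSp : ∀ v : HeightOneSpectrum (𝓞 K), ((p : ℕ) : 𝓞 K) ∈ v.asIdeal → v ∈ S)
    {Λ : Type} [CommRing Λ] [TopologicalSpace Λ] [IsTopologicalRing Λ] {mΛ : ℕ}
    (e : Λ ≃+* MvPowerSeries (Fin mΛ) ℤ_[p])
    {D : Type} [AddCommGroup D] [Module Λ D] [TopologicalSpace D] [DiscreteTopology D]
    [ContinuousSMul Λ D] (ρ : ContinuousRep (GaloisGroupUnramifiedOutside K S) Λ D)
    (hD : IsCofinitelyGenerated Λ D) :
    (∀ i ≤ 2, IsCofinitelyGenerated Λ (ρ.H i)) ∧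
      ∀ (v : NumberField.Place K) (i : ℕ), IsCofinitelyGenerated Λ ((localRep S ρ v).H i) := by
  haveI : IsLocalRing Λ := isLocalRing_of_ringEquiv_mvPowerSeries e
  exact ⟨fun i hi => isCofinitelyGenerated_H_le_two_of_tate hT S hS hSp e ρ hD hi,
    fun v i => isCofinitelyGenerated_localRep_H S ρ e hD v i⟩

end Literature.NumberTheory.IwasawaTheory.Greenberg2006

end
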